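import Summits.AtomisticToContinuum.Crystallization.Theorems.ChartedZeroExcessLayeredLatticeLiouvilleG
import Summits.AtomisticToContinuum.Crystallization.Theorems.ChartedPlanarOrderCleanScaleP

/-!
# ChartedZeroExcessLayered · LatticeLiouville — part H/8: §W the `_16dW` / `_16hW` columns at the WIDENED pattern scale `aHi = 103/100` (decomp-a2c
lens-2 generation 25 = v9; NEW content; critic row 444 (A2) «add the `_16dW` column», R1-N).  ONE namespace `…Theorems.ChartedZeroExcessLayeredLatticeLiouville`
across the parts; imports part G and lens-3's tree module `…ChartedPlanarOrderCleanScaleP` (the parametric door binders `IsDoorSetP aHi` /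
`DoorPeriodicP Λ aHi`; `IsDoorSetP 1 δ S ↔ IsDoorSet δ S`, `DoorPeriodicP Λ 1 ↔ DoorPeriodic Λ` by `Iff.rfl`).  `IsDoorSetP (103/100)` /
`DoorPeriodicP Λ (103/100)` ARE lens-4's `IsDoorSetW` / `DoorPeriodicW Λ` (tree `…OverbindingBudgetScaleWidening`) by `Iff.rfl` — that module is NOT
imported here (it would pull the whole budget cone into this one); the one-line bridge is an `example` in the g25 probes file.
Oscillation θ_W = aHi/16 = 103/1600 (the affine-goodness calibration `isTwoShellAffineGood_of_good` at pattern scale ≤ aHi: `affineGood_of_isDoorSetP`,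
so the bootstrap stays FREE); misfit levels κ₁ = 1/16, κ₀ = 1/64 kept ABSOLUTE (environment-misfit lengths at radius 4 are absolute; R_W at absolute
1/16 is marginally STRONGER than the scale-covariant `(103/100)²/16` reading and implies it by `OscRigidityL2BDP.mono`).  Every P-piece at `aHi' ≥ aHi`
implies the one at `aHi` (more door sets = a STRONGER statement: `.anti`); at `aHi = 1` they are the v8/v9 decls (`_one_iff`, `Iff.rfl`).
-/

noncomputable section

open scoped BigOperators InnerProductSpace RealInnerProductSpace
open MeasureTheory Set Metric Filter Topology
open Summit.AtomisticToContinuum.Crystallization.Theorems.ChartedPlanarOrderRigidityDoor (E3 IsClean IsNash IsCharted VisibleGap PertRegime atomsIn)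
open Summit.AtomisticToContinuum.Crystallization.Theorems.ChartedPlanarOrderDensityDichotomy (μS IsSep nK nK_nonneg)
open Summit.AtomisticToContinuum.Crystallization.Theorems.ChartedPlanarOrderMesoCut (IsDoorSet NearHom LayeredHom EnvClose)
open Summit.AtomisticToContinuum.Crystallization.Theorems.OverbindingBudgetLiouvilleDictionary (NearHomBD nearHom_of_nearHomBD)
open Summit.AtomisticToContinuum.Crystallization.Theorems.ChartedPlanarOrderDoorLayered
  (TwoPeriodic not_twoPeriodic_singleton DoorHomogeneityBD DoorPeriodic PeriodicBulkGapDoor PeriodicBulkGap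
   doorPeriodic_of_doorHomogeneityBD gap_and_pert_1_50_of_periodic gap_and_pert_1_50_of_periodic'
   NearHomL2BD CleanScaleCoherenceL2BD FlatnessExactL2BD doorPeriodic_of_L2 cleanScaleCoherenceL2BD_of_large nearHomL2BD_mono Layered
   IsPeriod IsPeriod.neg isPeriod_layered_fst isPeriod_layered_snd layeredHom_eq_layered linearIndependent_triangularVec
   norm_map_triangularVec_le norm_le_norm_symm_mul layeredHom_add_gen₁ layeredHom_add_gen₂ exists_atom_near_gen
   nearHomBD_of_nearHomL2BD nearHomBD_mono_tol add_mem_of_near_translates not_nearHomL2BD_singleton)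
open Summit.AtomisticToContinuum.Crystallization.Theorems.ChartedPlanarOrderDoorLayeredOsc
  (IsTwoShellAffineGood OscillationImprovement DoorPeriodicOsc doorPeriodic_of_osc doorPeriodicOsc_of_doorPeriodic
   oscillationImprovement_of_ge mem_iff_μS_singleton_ne_zero isTwoShellAffineGood_of_good)
open Literature.MathematicalPhysics.StatisticalMechanics (triangularVec₁ triangularVec₂)
open Summit.AtomisticToContinuum.Crystallization.Theorems.ChartedPlanarOrderCleanScaleP
  (IsCleanP IsDoorSetP DoorPeriodicP isCleanP_μS_iff isDoorSetP_mono doorPeriodic_of_doorPeriodicP isDoorSetP_one_iff doorPeriodicP_one_iff)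

namespace Summit.AtomisticToContinuum.Crystallization.Theorems.ChartedZeroExcessLayeredLatticeLiouville

/-! ## §W  the pieces at pattern-scale ceiling `aHi` and the widened columns -/

/-- R at pattern-scale ceiling `aHi` (`OscRigidityL2BD` over `IsDoorSetP aHi` door sets). [this file, v9] -/
def OscRigidityL2BDP (aHi Λ θ κ : ℝ) : Prop :=
  ∀ δ : ℝ, 0 < δ → ∀ S : Set E3, IsDoorSetP aHi δ S → (∀ q ∈ S, IsTwoShellAffineGood θ S q) →
    ∀ R : ℝ, 0 < R → NearHomL2BD Λ κ 4 S (atomsIn (μS S) 0 R)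

/-- D at pattern-scale ceiling `aHi`. [this file, v9] -/
def OscFlatnessDecayP (aHi Λ θ κ₁ κ₀ : ℝ) : Prop :=
  ∀ δ : ℝ, 0 < δ → ∀ S : Set E3, IsDoorSetP aHi δ S → (∀ q ∈ S, IsTwoShellAffineGood θ S q) →
    (∀ R : ℝ, 0 < R → NearHomL2BD Λ κ₁ 4 S (atomsIn (μS S) 0 R)) → ∀ R : ℝ, 0 < R → NearHomL2BD Λ κ₀ 4 S (atomsIn (μS S) 0 R)

/-- P♭ at pattern-scale ceiling `aHi`. [this file, v9] -/
def LinearisedFlatnessLayeredP (aHi Λ θ κ : ℝ) : Prop :=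
  LatticeLiouvilleCert → LayeredLiouvilleCert → ∀ δ : ℝ, 0 < δ → ∀ S : Set E3, IsDoorSetP aHi δ S →
    (∀ q ∈ S, IsTwoShellAffineGood θ S q) → (∀ R : ℝ, 0 < R → NearHomL2BD Λ κ 4 S (atomsIn (μS S) 0 R)) → TwoPeriodic Λ S

/-- H at pattern-scale ceiling `aHi` (`FlatnessHalving` over `IsDoorSetP aHi` door sets). [this file, v9] -/
def FlatnessHalvingP (aHi Λ θ κ : ℝ) : Prop :=
  LatticeLiouvilleCert → LayeredLiouvilleCert → ∀ δ : ℝ, 0 < δ → ∃ M : ℝ, 1 ≤ M ∧ ∃ R₀ : ℝ, 0 < R₀ ∧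
    ∀ S : Set E3, IsDoorSetP aHi δ S → (∀ q ∈ S, IsTwoShellAffineGood θ S q) →
      ∀ η : ℝ, 0 < η → η ≤ κ → ∀ R : ℝ, R₀ ≤ R →
        NearHomL2BD Λ η 4 S (atomsIn (μS S) 0 (M * R)) → NearHomL2BD Λ (η / 2) 4 S (atomsIn (μS S) 0 R)

/-- N″(Λ, θ) at pattern-scale ceiling `aHi` (`DoorPeriodicOsc` widened). [this file, v9] -/
def DoorPeriodicOscP (aHi Λ θ : ℝ) : Prop :=
  ∀ δ : ℝ, 0 < δ → ∀ S : Set E3, IsDoorSetP aHi δ S → (∀ q ∈ S, IsTwoShellAffineGood θ S q) → TwoPeriodic Λ S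

/-- at `aHi = 1`, R_P IS the v8 R. -/
theorem oscRigidityL2BDP_one_iff (Λ θ κ : ℝ) : OscRigidityL2BDP 1 Λ θ κ ↔ OscRigidityL2BD Λ θ κ := Iff.rfl

/-- at `aHi = 1`, D_P IS the v8 D. -/
theorem oscFlatnessDecayP_one_iff (Λ θ κ₁ κ₀ : ℝ) : OscFlatnessDecayP 1 Λ θ κ₁ κ₀ ↔ OscFlatnessDecay Λ θ κ₁ κ₀ := Iff.rfl

/-- at `aHi = 1`, P♭_P IS the v8 P♭. -/
theorem linearisedFlatnessLayeredP_one_iff (Λ θ κ : ℝ) : LinearisedFlatnessLayeredP 1 Λ θ κ ↔ LinearisedFlatnessLayered Λ θ κ := Iff.rfl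

/-- at `aHi = 1`, H_P IS the v9 H. -/
theorem flatnessHalvingP_one_iff (Λ θ κ : ℝ) : FlatnessHalvingP 1 Λ θ κ ↔ FlatnessHalving Λ θ κ := Iff.rfl

/-- at `aHi = 1`, N″_P IS N″ (`DoorPeriodicOsc`). -/
theorem doorPeriodicOscP_one_iff (Λ θ : ℝ) : DoorPeriodicOscP 1 Λ θ ↔ DoorPeriodicOsc Λ θ := Iff.rfl

/-- R_P is ANTITONE in the ceiling (a larger window of clean scales = more door sets = a STRONGER statement). -/
theorem OscRigidityL2BDP.anti {aHi aHi' Λ θ κ : ℝ} (hle : aHi ≤ aHi') (h : OscRigidityL2BDP aHi' Λ θ κ) : OscRigidityL2BDP aHi Λ θ κ :=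
  fun δ hδ S hS => h δ hδ S (isDoorSetP_mono hle hS)

/-- D_P is ANTITONE in the ceiling. -/
theorem OscFlatnessDecayP.anti {aHi aHi' Λ θ κ₁ κ₀ : ℝ} (hle : aHi ≤ aHi') (h : OscFlatnessDecayP aHi' Λ θ κ₁ κ₀) :
    OscFlatnessDecayP aHi Λ θ κ₁ κ₀ :=
  fun δ hδ S hS => h δ hδ S (isDoorSetP_mono hle hS)

/-- P♭_P is ANTITONE in the ceiling. -/
theorem LinearisedFlatnessLayeredP.anti {aHi aHi' Λ θ κ : ℝ} (hle : aHi ≤ aHi') (h : LinearisedFlatnessLayeredP aHi' Λ θ κ) :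
    LinearisedFlatnessLayeredP aHi Λ θ κ :=
  fun hP hL δ hδ S hS => h hP hL δ hδ S (isDoorSetP_mono hle hS)

/-- H_P is ANTITONE in the ceiling. -/
theorem FlatnessHalvingP.anti {aHi aHi' Λ θ κ : ℝ} (hle : aHi ≤ aHi') (h : FlatnessHalvingP aHi' Λ θ κ) : FlatnessHalvingP aHi Λ θ κ := by
  intro hP hL δ hδ
  obtain ⟨M, hM, R₀, hR₀, hstep⟩ := h hP hL δ hδ
  exact ⟨M, hM, R₀, hR₀, fun S hS => hstep S (isDoorSetP_mono hle hS)⟩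

/-- N″_P is ANTITONE in the ceiling. -/
theorem DoorPeriodicOscP.anti {aHi aHi' Λ θ : ℝ} (hle : aHi ≤ aHi') (h : DoorPeriodicOscP aHi' Λ θ) : DoorPeriodicOscP aHi Λ θ :=
  fun δ hδ S hS => h δ hδ S (isDoorSetP_mono hle hS)

/-- R_P is MONOTONE in κ (passes between the absolute and the scale-covariant level readings). -/
theorem OscRigidityL2BDP.mono {aHi Λ θ κ κ' : ℝ} (hκ : κ ≤ κ') (h : OscRigidityL2BDP aHi Λ θ κ) : OscRigidityL2BDP aHi Λ θ κ' :=
  fun δ hδ S hS hO R hR => nearHomL2BD_mono hκ (h δ hδ S hS hO R hR)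

/-- **the bootstrap at ceiling `aHi` is FREE for `θ ≥ aHi/16`**: every atom of an `aHi`-door set is `θ`-affine-good (calibration
`isTwoShellAffineGood_of_good` with `(ε, aLo, aHi) = (1/16, 9/10, aHi)`, via lens-3's `isCleanP_μS_iff`). -/
theorem affineGood_of_isDoorSetP {aHi δ θ : ℝ} (hθ : aHi / 16 ≤ θ) {S : Set E3} (hS : IsDoorSetP aHi δ S) :
    ∀ q ∈ S, IsTwoShellAffineGood θ S q := fun q hq =>
  isTwoShellAffineGood_of_good (by norm_num) (by norm_num) (by linarith) ((isCleanP_μS_iff S).1 hS.2.2.1 q hq)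

/-- the widened bootstrap seam: N″_P ⟹ `DoorPeriodicP Λ aHi` for `θ ≥ aHi/16`. -/
theorem doorPeriodicP_of_oscP {aHi Λ θ : ℝ} (hθ : aHi / 16 ≤ θ) (h : DoorPeriodicOscP aHi Λ θ) : DoorPeriodicP Λ aHi :=
  fun δ hδ S hS => h δ hδ S hS (affineGood_of_isDoorSetP hθ hS)

/-- ★ **R_P ∧ D_P ∧ P♭_P ∧ both certificates ⟹ N″_P** at every ceiling. -/
theorem doorPeriodicOscP_of_three {aHi Λ θ κ₁ κ₀ : ℝ} (hL : LatticeLiouvilleCert) (hL' : LayeredLiouvilleCert)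
    (hR : OscRigidityL2BDP aHi Λ θ κ₁) (hD : OscFlatnessDecayP aHi Λ θ κ₁ κ₀) (hP : LinearisedFlatnessLayeredP aHi Λ θ κ₀) :
    DoorPeriodicOscP aHi Λ θ :=
  fun δ hδ S hS hO => hP hL hL' δ hδ S hS hO (hD δ hδ S hS hO (fun R hRpos => hR δ hδ S hS hO R hRpos))

/-- ★ **P♭_P ⟸ H_P at every ceiling** (`Λ ≤ 4`, `0 < κ`): the iteration of §E verbatim, then the exact endgame Z = `exactEndgame_of_le`
(`IsDoorSetP` door sets are rooted `hS.1` and separated `hS.2.1`). -/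
theorem linearisedFlatnessLayeredP_of_halvingP {aHi Λ θ κ : ℝ} (hΛ : Λ ≤ 4) (hκ : 0 < κ) (hH : FlatnessHalvingP aHi Λ θ κ) :
    LinearisedFlatnessLayeredP aHi Λ θ κ := by
  intro hP hL δ hδ S hS hO hflat
  obtain ⟨M, hM, R₀, hR₀, hstep⟩ := hH hP hL δ hδ
  have iter : ∀ k : ℕ, ∀ R : ℝ, R₀ ≤ R → NearHomL2BD Λ (κ / 2 ^ k) 4 S (atomsIn (μS S) 0 R) := by
    intro k
    induction k with
    | zero => intro R hR; simpa using hflat R (hR₀.trans_le hR)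
    | succ k ih =>
      intro R hR
      have hMR : R₀ ≤ M * R := hR.trans (le_mul_of_one_le_left (hR₀.le.trans hR) hM)
      have h1 := hstep S hS hO (κ / 2 ^ k) (by positivity)
        (div_le_self hκ.le (one_le_pow₀ (by norm_num))) R hR (ih (M * R) hMR)
      rwa [pow_succ, ← div_div]
  refine exactEndgame_of_le hΛ δ hδ S hS.1 hS.2.1 ⟨R₀, fun ε hε R hR => ?_⟩
  obtain ⟨k, hk⟩ := exists_pow_lt_of_lt_one (div_pos hε hκ) (by norm_num : (1 / 2 : ℝ) < 1)
  refine nearHomL2BD_mono ?_ (iter k R hR)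
  rw [div_eq_mul_inv, ← inv_pow, show ((2:ℝ)⁻¹) = 1 / 2 by norm_num]
  have := (lt_div_iff₀ hκ).1 hk
  linarith [this]

/-- ★★ **THE `_16dW` COLUMN, door half**: `LatticeLiouvilleCert → LayeredLiouvilleCert → R_W(2, 103/1600, 1/16) → D_W(2, 103/1600, 1/16, 1/64) →
P♭_W(2, 103/1600, 1/64) → DoorPeriodicP 2 (103/100)` — the last IS lens-4's slot `DoorPeriodicW 2` of the THIRTEENTH cone (`Iff.rfl`). -/
theorem doorPeriodicW_of_certs_16dW (hL : LatticeLiouvilleCert) (hL' : LayeredLiouvilleCert)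
    (hR : OscRigidityL2BDP (103 / 100) 2 (103 / 1600) (1 / 16)) (hDec : OscFlatnessDecayP (103 / 100) 2 (103 / 1600) (1 / 16) (1 / 64))
    (hP : LinearisedFlatnessLayeredP (103 / 100) 2 (103 / 1600) (1 / 64)) : DoorPeriodicP 2 (103 / 100) :=
  doorPeriodicP_of_oscP (by norm_num) (doorPeriodicOscP_of_three hL hL' hR hDec hP)

/-- ★★ **THE `_16dW` COLUMN to the summit conjuncts — SIX leaves**: `LatticeLiouvilleCert → LayeredLiouvilleCert → R_W → D_W → P♭_W → HBG″ →
VisibleGap (1/50) ∧ PertRegime (1/50)` (through `doorPeriodic_of_doorPeriodicP`, `1 ≤ 103/100`, and the tree's `gap_and_pert_1_50_of_periodic`). -/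
theorem gap_and_pert_1_50_of_certs_16dW (hL : LatticeLiouvilleCert) (hL' : LayeredLiouvilleCert)
    (hR : OscRigidityL2BDP (103 / 100) 2 (103 / 1600) (1 / 16)) (hDec : OscFlatnessDecayP (103 / 100) 2 (103 / 1600) (1 / 16) (1 / 64))
    (hP : LinearisedFlatnessLayeredP (103 / 100) 2 (103 / 1600) (1 / 64)) (hG : PeriodicBulkGapDoor 2) :
    VisibleGap (1 / 50) ∧ PertRegime (1 / 50) :=
  gap_and_pert_1_50_of_periodic (doorPeriodic_of_doorPeriodicP (by norm_num) (doorPeriodicW_of_certs_16dW hL hL' hR hDec hP)) hG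

/-- ★★ **THE `_16hW` COLUMN — SIX leaves, H-form**: `LatticeLiouvilleCert → LayeredLiouvilleCert → R_W → D_W → H_W(2, 103/1600, 1/64) → HBG″ →
VisibleGap (1/50) ∧ PertRegime (1/50)` (P♭_W ⟸ H_W by `linearisedFlatnessLayeredP_of_halvingP`). -/
theorem gap_and_pert_1_50_of_certs_16hW (hL : LatticeLiouvilleCert) (hL' : LayeredLiouvilleCert)
    (hR : OscRigidityL2BDP (103 / 100) 2 (103 / 1600) (1 / 16)) (hDec : OscFlatnessDecayP (103 / 100) 2 (103 / 1600) (1 / 16) (1 / 64))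
    (hH : FlatnessHalvingP (103 / 100) 2 (103 / 1600) (1 / 64)) (hG : PeriodicBulkGapDoor 2) : VisibleGap (1 / 50) ∧ PertRegime (1 / 50) :=
  gap_and_pert_1_50_of_certs_16dW hL hL' hR hDec (linearisedFlatnessLayeredP_of_halvingP (by norm_num) (by norm_num) hH) hG

/-- the W-pieces give the v8 pieces (drop to `aHi = 1`, then `θ = 103/1600 ↦ 1/16` by antitonicity): the `_16dW` column is leafwise STRONGER than `_16d`. -/
theorem oscRigidityL2BD_of_W (hR : OscRigidityL2BDP (103 / 100) 2 (103 / 1600) (1 / 16)) : OscRigidityL2BD 2 (1 / 16) (1 / 16) :=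
  ((oscRigidityL2BDP_one_iff _ _ _).1 (hR.anti (by norm_num))).anti_mono (by norm_num) le_rfl

/-- likewise for P♭: P♭_W(2, 103/1600, 1/64) ⟹ P♭(2, 1/16, 1/64). -/
theorem linearisedFlatnessLayered_of_W (hP : LinearisedFlatnessLayeredP (103 / 100) 2 (103 / 1600) (1 / 64)) :
    LinearisedFlatnessLayered 2 (1 / 16) (1 / 64) :=
  ((linearisedFlatnessLayeredP_one_iff _ _ _).1 (hP.anti (by norm_num))).anti_anti (by norm_num) le_rfl

end Summit.AtomisticToContinuum.Crystallization.Theorems.ChartedZeroExcessLayeredLatticeLiouville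

end
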